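import Summits.RiemannHypothesis.RiemannHypothesis.Theorems.WeilBochnerMeasureGramEntries
import Summits.RiemannHypothesis.RiemannHypothesis.Theorems.WeilBochnerMeasureCounting
import Summits.Ventures.WeilGRH.FlatWindowSpectral
import Summits.Ventures.WeilGRH.TwistedWindowMeasureGrowth
import Literature.NumberTheory.LFunctions.WeilBochnerRepresentationRH
import Literature.NumberTheory.LFunctions.WeilZeroSum
import HarnessLib

/-!
# rh-explicit (venture WeilGRH): GRAM-FORM EXCLUSION — every finite principal block of Yoshida's Gram matrix,
  tested on ONE real coefficient vector, is a zero-free-block certificate (weil-3 gen16)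

Cell `rh-explicit`, WEIL TRACK (structure seat weil-3, gen16).  Measure level, RH-free unless named.

Let `a > 0` and let `μ` be ANY positive measure representing Weil's form on the tests of `[-a, a]`
(a «Weil measure of the rung `a`»; such `μ` exist iff `WeilPositivityOn a`, unconditionally for
`a ≤ 4023/5000`).  For a finite set of modes `s ⊂ ℤ` and a REAL coefficient vector `x`, the trigonometric
window `u = Σ_{n∈s} x_n χ_n` has window form `Σ_{n,k∈s} x_n x_k G_a(n,k)` (Yoshida's Gram matrix (5.15)/(5.16),
computed from the prime powers `< e^{2a}`, `Γ` and the pole — no zeros of `ζ` anywhere), and by the structure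
seat's moment theorem (`WeilBochnerMeasureWindow.sum_mul_mul_gramCoeff_eq_integral`, BUILT)

  `Σ_{n,k∈s} x_n x_k G_a(n,k) = ∫ ‖û(½+it)‖² dμ(t)`.

Hence (this file):

* ★ `blockMass_le_gramForm` — if `m ≤ ‖û(½+it)‖²` on `[l, r]` then **`m · μ[l, r] ≤ xᵀ G_a x`**: the value of
  the finite Gram form on ONE vector bounds the spectral mass of a whole block, for EVERY Weil measure of the
  rung (gen15's `blockMass_le_gramCoeff` is the one-mode case `s = {n}`, `x = 1`, profile `2a·sinc²`);
* `profileMass_atom_le_gramForm` — the point case: **`‖û(½+it₀)‖² · μ{t₀} ≤ xᵀ G_a x`**; optimising over `x`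
  this is the CHRISTOFFEL FUNCTION `Λ_s(t₀) = 1/(v(t₀)ᵀ G_s⁻¹ v(t₀))` (`v_n = χ̂_n(½+it₀)`) of the rung's Gram
  block — the sharp upper envelope of the atoms of all Weil measures of the rung on the span of the modes `s`;
* `gramForm_nonneg_of_represents`, `measureReal_block_lt_one_of_gramForm_lt`,
  ★ `measure_block_eq_zero_of_natValued_of_gramForm_lt` (ℕ-valued Weil measures VANISH on every block whose
  certificate value is below the profile floor) and ★ `im_not_mem_block_of_riemannHypothesis_of_gramForm_lt`
  (under RH no zero of `ζ` has its ordinate there: `ν_ζ` is a Weil measure with unit atoms at the ordinates);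
* the EXPLICIT PROFILE (what a certificate checker evaluates): `weilMellin_chi_eq_sinc`
  (`χ̂_n(½+it) = 2(−1)^n sin(at)/((t + πn/a)√(2a))` off the lattice point), `weilMellin_sum_smul_chi_eq_sinc`
  and ★ `norm_sq_weilMellin_sum_smul_chi_eq`:
  **`‖û(½+it)‖² = (2/a)·sin²(at)·(Σ_{n∈s} (−1)^n x_n/(t + πn/a))²`** for `t` off the lattice points of `s` —
  a squared rational function times `sin²`, so «`m ≤ ‖û‖²` on `[l,r]`» is a finite trigonometric inequality.

So a finite certificate of the shape (modes `s`, rational vector `x`, block `[l,r]`, floor `m`, certified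
upper bound `xᵀG_a x < m`) is a THEOREM «no arithmetic Weil-positive spectrum of the rung has a line in
`[l,r]`» — the finite object is one principal block of Yoshida's matrix and one vector.  Numerically (seat
folder `py/christoffel.py`, prime-side entries to 40 digits) the 21-mode block `|n| ≤ 10` of the proved rung
`a₀ = 4023/5000` has smallest eigenvalue `1.6·10⁻¹⁶` (the prolate near-kernel of Connes–Consani–Moscovici,
arXiv:2511.22755, seen from the measure side) and its Christoffel function is `< 10⁻⁵` on `[0, 21] ∖ (γ₁ ± 10⁻⁴)`
while `Λ(γ_j) = 1` to `10⁻⁸` at `ζ`'s first five zeros: the data «prime powers 2, 3, 4 + Γ + pole» pin the low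
lines of every ℕ-valued Weil-positive spectrum to within `10⁻⁶ … 10⁻³` of `ζ`'s zeros (STRUCTURE §24).
No definitions, no named facts, standard axioms; nothing here bears on the truth of RH.
-/

set_option autoImplicit false

noncomputable section

open Complex Set MeasureTheory
open scoped Real ENNReal ComplexConjugate

namespace Summit.Ventures.WeilGRH

open Literature.NumberTheory.LFunctions
open Literature.NumberTheory.LFunctions.Yoshida1992 (chi gramCoeff)
open Literature.NumberTheory.LFunctions.ZetaZeros (riemannZetaNontrivialZeros)
open Literature.NumberTheory.LFunctions.WeilBochner (zetaZeroHeightMeasure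
  weilQuadratic_eq_integral_of_riemannHypothesis)
open Summit.RiemannHypothesis.RiemannHypothesis.Theorems.WeilFormatC
open Summit.RiemannHypothesis.RiemannHypothesis.Theorems.WeilBochnerMeasure (weilWindowForm_sum_smul_chi_eq_integral
  sum_mul_mul_gramCoeff_eq_integral weilMellin_sum_smul_chi measure_Icc_lt_top)

variable {a : ℝ}

/-! ## The finite Gram form on one vector bounds the mass of a block -/

/-- **The Gram form is a square integral**, hence non-negative, for every representing measure:
`0 ≤ Σ_{n,k∈s} x_n x_k G_a(n,k)`. -/
theorem gramForm_nonneg_of_represents (ha : 0 < a) {μ : Measure ℝ}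
    (hμ : ∀ g : ℝ → ℂ, IsWeilTest g → tsupport g ⊆ Icc (-a) a →
      Integrable (fun t : ℝ ↦ ‖weilMellin g (1 / 2 + t * I)‖ ^ 2) μ ∧
        weilQuadratic g = ((∫ t, ‖weilMellin g (1 / 2 + t * I)‖ ^ 2 ∂μ : ℝ) : ℂ))
    (s : Finset ℤ) (x : ℤ → ℝ) :
    0 ≤ ∑ n ∈ s, ∑ k ∈ s, x n * x k * gramCoeff a n k := by
  rw [sum_mul_mul_gramCoeff_eq_integral ha hμ s x]
  exact integral_nonneg fun t ↦ by positivity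

/-- ★ **GRAM-FORM EXCLUSION, quantitative form** (RH-free).  For `a > 0`, every positive `μ` representing Weil's
form on the tests of `[-a, a]`, every finite set of modes `s`, every real vector `x` and every block `[l, r]` on
which the profile of `u = Σ_{n∈s} x_n χ_n` is at least `m`:

  `m · μ[l, r] ≤ Σ_{n,k∈s} x_n x_k G_a(n,k)`. -/
theorem blockMass_le_gramForm (ha : 0 < a) {μ : Measure ℝ}
    (hμ : ∀ g : ℝ → ℂ, IsWeilTest g → tsupport g ⊆ Icc (-a) a →
      Integrable (fun t : ℝ ↦ ‖weilMellin g (1 / 2 + t * I)‖ ^ 2) μ ∧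
        weilQuadratic g = ((∫ t, ‖weilMellin g (1 / 2 + t * I)‖ ^ 2 ∂μ : ℝ) : ℂ))
    (s : Finset ℤ) (x : ℤ → ℝ) {l r m : ℝ}
    (hm : ∀ t ∈ Icc l r, m ≤ ‖weilMellin (∑ n ∈ s, (x n : ℂ) • chi a n) (1 / 2 + t * I)‖ ^ 2) :
    m * μ.real (Icc l r) ≤ ∑ n ∈ s, ∑ k ∈ s, x n * x k * gramCoeff a n k := by
  have hint := (weilWindowForm_sum_smul_chi_eq_integral ha hμ s (fun n ↦ (x n : ℂ))).1
  have heq := sum_mul_mul_gramCoeff_eq_integral ha hμ s x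
  have hBfin : μ (Icc l r) ≠ ⊤ := (measure_Icc_lt_top ha hμ l r).ne
  have hind : Integrable ((Icc l r).indicator fun _ ↦ m) μ :=
    (integrable_indicator_iff measurableSet_Icc).2 (integrableOn_const hBfin)
  have hle : ∀ t : ℝ, (Icc l r).indicator (fun _ ↦ m) t ≤
      ‖weilMellin (∑ n ∈ s, (x n : ℂ) • chi a n) (1 / 2 + t * I)‖ ^ 2 := by
    intro t
    by_cases ht : t ∈ Icc l r
    · rw [indicator_of_mem ht]; exact hm t ht
    · rw [indicator_of_notMem ht]; positivity
  calc m * μ.real (Icc l r) = ∫ t, (Icc l r).indicator (fun _ ↦ m) t ∂μ := by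
        rw [integral_indicator_const _ measurableSet_Icc, smul_eq_mul, mul_comm]
    _ ≤ ∫ t, ‖weilMellin (∑ n ∈ s, (x n : ℂ) • chi a n) (1 / 2 + t * I)‖ ^ 2 ∂μ :=
        integral_mono hind hint hle
    _ = ∑ n ∈ s, ∑ k ∈ s, x n * x k * gramCoeff a n k := heq.symm

/-- **The point case (Christoffel bound)**: `‖û(½+it₀)‖² · μ{t₀} ≤ xᵀ G_a x` for `u = Σ_{n∈s} x_n χ_n` and every Weil
measure of the rung; the infimum over `x` of the right side at fixed `û(½+it₀) = 1` is the Christoffel function of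
the Gram block. -/
theorem profileMass_atom_le_gramForm (ha : 0 < a) {μ : Measure ℝ}
    (hμ : ∀ g : ℝ → ℂ, IsWeilTest g → tsupport g ⊆ Icc (-a) a →
      Integrable (fun t : ℝ ↦ ‖weilMellin g (1 / 2 + t * I)‖ ^ 2) μ ∧
        weilQuadratic g = ((∫ t, ‖weilMellin g (1 / 2 + t * I)‖ ^ 2 ∂μ : ℝ) : ℂ))
    (s : Finset ℤ) (x : ℤ → ℝ) (t₀ : ℝ) :
    ‖weilMellin (∑ n ∈ s, (x n : ℂ) • chi a n) (1 / 2 + t₀ * I)‖ ^ 2 * μ.real {t₀} ≤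
      ∑ n ∈ s, ∑ k ∈ s, x n * x k * gramCoeff a n k := by
  have h := blockMass_le_gramForm ha hμ s x (l := t₀) (r := t₀)
    (m := ‖weilMellin (∑ n ∈ s, (x n : ℂ) • chi a n) (1 / 2 + t₀ * I)‖ ^ 2) (fun t ht ↦ by
      rw [mem_Icc] at ht
      rw [show t = t₀ from le_antisymm ht.2 ht.1])
  rwa [Icc_self] at h

/-- **A certificate value below the floor gives mass `< 1`**: if `m ≤ ‖û‖²` on `[l, r]` and `xᵀ G_a x < m`, then
`μ[l, r] < 1` for every Weil measure of the rung. -/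
theorem measureReal_block_lt_one_of_gramForm_lt (ha : 0 < a) {μ : Measure ℝ}
    (hμ : ∀ g : ℝ → ℂ, IsWeilTest g → tsupport g ⊆ Icc (-a) a →
      Integrable (fun t : ℝ ↦ ‖weilMellin g (1 / 2 + t * I)‖ ^ 2) μ ∧
        weilQuadratic g = ((∫ t, ‖weilMellin g (1 / 2 + t * I)‖ ^ 2 ∂μ : ℝ) : ℂ))
    (s : Finset ℤ) (x : ℤ → ℝ) {l r m : ℝ}
    (hm : ∀ t ∈ Icc l r, m ≤ ‖weilMellin (∑ n ∈ s, (x n : ℂ) • chi a n) (1 / 2 + t * I)‖ ^ 2)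
    (hlt : ∑ n ∈ s, ∑ k ∈ s, x n * x k * gramCoeff a n k < m) :
    μ.real (Icc l r) < 1 := by
  have h := blockMass_le_gramForm ha hμ s x hm
  have h0 := gramForm_nonneg_of_represents ha hμ s x
  have hμ0 : 0 ≤ μ.real (Icc l r) := measureReal_nonneg
  by_contra hge
  have hge' : 1 ≤ μ.real (Icc l r) := not_lt.1 hge
  nlinarith

/-- ★ **GRAM-FORM EXCLUSION** (RH-free).  For `a > 0`, a finite set of modes `s`, a real vector `x`, a block
`[l, r]` with `m ≤ ‖(Σ x_n χ_n)^(½+it)‖²` on it and `Σ x_n x_k G_a(n,k) < m`: every positive `μ` representing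
Weil's form on `[-a, a]` that is ℕ-valued on bounded Borel sets has **`μ[l, r] = 0`**. -/
theorem measure_block_eq_zero_of_natValued_of_gramForm_lt (ha : 0 < a) {μ : Measure ℝ}
    (hμ : ∀ g : ℝ → ℂ, IsWeilTest g → tsupport g ⊆ Icc (-a) a →
      Integrable (fun t : ℝ ↦ ‖weilMellin g (1 / 2 + t * I)‖ ^ 2) μ ∧
        weilQuadratic g = ((∫ t, ‖weilMellin g (1 / 2 + t * I)‖ ^ 2 ∂μ : ℝ) : ℂ))
    (hN : ∀ S : Set ℝ, MeasurableSet S → Bornology.IsBounded S → ∃ k : ℕ, μ.real S = k)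
    (s : Finset ℤ) (x : ℤ → ℝ) {l r m : ℝ}
    (hm : ∀ t ∈ Icc l r, m ≤ ‖weilMellin (∑ n ∈ s, (x n : ℂ) • chi a n) (1 / 2 + t * I)‖ ^ 2)
    (hlt : ∑ n ∈ s, ∑ k ∈ s, x n * x k * gramCoeff a n k < m) :
    μ (Icc l r) = 0 := by
  obtain ⟨k, hk⟩ := hN _ measurableSet_Icc (Metric.isBounded_Icc l r)
  have h1 := measureReal_block_lt_one_of_gramForm_lt ha hμ s x hm hlt
  rw [hk] at h1
  have hk1 : k < 1 := by exact_mod_cast h1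
  have hk0 : k = 0 := Nat.lt_one_iff.1 hk1
  have h0 : μ.real (Icc l r) = 0 := by rw [hk, hk0, Nat.cast_zero]
  rw [measureReal_def, ENNReal.toReal_eq_zero_iff] at h0
  exact h0.resolve_right (measure_Icc_lt_top ha hμ l r).ne

/-- ★ **ONE VECTOR ON ONE GRAM BLOCK IS A ZERO-FREE-BLOCK CERTIFICATE FOR `ζ`** (under RH).  If the Riemann
hypothesis holds, then for every `a > 0`, modes `s`, real `x` and block `[l, r]` with `m ≤ ‖(Σ x_n χ_n)^(½+it)‖²`
on it and `Σ x_n x_k G_a(n,k) < m`, NO non-trivial zero of `ζ` has its ordinate in `[l, r]`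
(`ν_ζ = Σ_ρ m(ρ)δ_{Im ρ}` represents Weil's form under RH and gives mass `≥ 1` to any set holding an ordinate). -/
theorem im_not_mem_block_of_riemannHypothesis_of_gramForm_lt (hRH : RiemannHypothesis) (ha : 0 < a)
    (s : Finset ℤ) (x : ℤ → ℝ) {l r m : ℝ}
    (hm : ∀ t ∈ Icc l r, m ≤ ‖weilMellin (∑ n ∈ s, (x n : ℂ) • chi a n) (1 / 2 + t * I)‖ ^ 2)
    (hlt : ∑ n ∈ s, ∑ k ∈ s, x n * x k * gramCoeff a n k < m)
    {ρ : ℂ} (hρ : ρ ∈ riemannZetaNontrivialZeros) :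
    ρ.im ∉ Icc l r := by
  have hν : ∀ g : ℝ → ℂ, IsWeilTest g → tsupport g ⊆ Icc (-a) a →
      Integrable (fun t : ℝ ↦ ‖weilMellin g (1 / 2 + t * I)‖ ^ 2) zetaZeroHeightMeasure ∧
        weilQuadratic g = ((∫ t, ‖weilMellin g (1 / 2 + t * I)‖ ^ 2 ∂zetaZeroHeightMeasure : ℝ) : ℂ) :=
    fun _ hg _ ↦ weilQuadratic_eq_integral_of_riemannHypothesis hRH hg
  intro hmem
  have h1 := measureReal_block_lt_one_of_gramForm_lt ha hν s x hm hlt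
  have hfin : zetaZeroHeightMeasure (Icc l r) ≠ ⊤ := (measure_Icc_lt_top ha hν l r).ne
  -- `ν_ζ[l, r] ≥ 1`: the Dirac mass at `Im ρ` with weight `m(ρ) ≥ 1` sits inside
  have hle : ((riemannZetaZeroOrder ρ).toNat : ℝ≥0∞) • Measure.dirac ρ.im ≤ zetaZeroHeightMeasure := by
    rw [zetaZeroHeightMeasure]
    exact Measure.le_sum (fun ρ' : riemannZetaNontrivialZeros ↦
      ((riemannZetaZeroOrder (ρ' : ℂ)).toNat : ℝ≥0∞) • Measure.dirac (ρ' : ℂ).im) ⟨ρ, hρ⟩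
  have hord : (1 : ℝ≥0∞) ≤ ((riemannZetaZeroOrder ρ).toNat : ℝ≥0∞) := by
    have h := ZetaZeros.riemannZetaNontrivialZeros.one_le_order hρ
    have : 1 ≤ (riemannZetaZeroOrder ρ).toNat := by omega
    exact_mod_cast this
  have hdirac : (1 : ℝ≥0∞) ≤ Measure.dirac ρ.im (Icc l r) := by
    have h := Measure.le_dirac_apply (a := ρ.im) (s := Icc l r)
    rwa [indicator_of_mem hmem, Pi.one_apply] at h
  have hge : (1 : ℝ≥0∞) ≤ zetaZeroHeightMeasure (Icc l r) :=
    calc (1 : ℝ≥0∞) = 1 * 1 := (one_mul 1).symm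
      _ ≤ ((riemannZetaZeroOrder ρ).toNat : ℝ≥0∞) * Measure.dirac ρ.im (Icc l r) := mul_le_mul' hord hdirac
      _ = (((riemannZetaZeroOrder ρ).toNat : ℝ≥0∞) • Measure.dirac ρ.im) (Icc l r) := by
          rw [Measure.smul_apply, smul_eq_mul]
      _ ≤ zetaZeroHeightMeasure (Icc l r) := Measure.le_iff'.1 hle _
  have hge' : (1 : ℝ) ≤ zetaZeroHeightMeasure.real (Icc l r) := by
    rw [measureReal_def]
    have := ENNReal.toReal_mono hfin hge
    rwa [ENNReal.toReal_one] at this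
  linarith

/-! ## The explicit profile of a finite trigonometric window on the critical line -/

/-- **`χ̂_n(½+it) = 2(−1)^n sin(at) / ((t + πn/a)√(2a))`** off the lattice point `t ≠ −πn/a` (`a > 0`):
`χ_n = e^{i(πn/a)x}χ_0`, modulation shifts the flat window's `sinc` by `−πn/a`, and `sin(at + πn) = (−1)^n sin(at)`. -/
theorem weilMellin_chi_eq_sinc (ha : 0 < a) (n : ℤ) {t : ℝ} (ht : t + π * n / a ≠ 0) :
    weilMellin (chi a n) (1 / 2 + t * I) =
      (((-1 : ℝ) ^ n * (2 * Real.sin (a * t)) / ((t + π * n / a) * Real.sqrt (2 * a)) : ℝ) : ℂ) := by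
  have hchi : chi a n = fun y ↦ cexp (I * ((π * n / a) * y : ℝ)) * chi a 0 y := by
    funext y
    by_cases hy : y ∈ Icc (-a) a
    · rw [chi_apply_of_mem n hy, chi_apply_of_mem 0 hy]
      simp only [Int.cast_zero, mul_zero, zero_mul, zero_div, Complex.exp_zero, mul_one]
      rw [mul_comm]
      congr 1
      push_cast
      ring_nf
    · rw [chi_apply_of_not_mem n hy, chi_apply_of_not_mem 0 hy, mul_zero]
  rw [hchi, weilMellin_modulate, weilMellin_chi_zero ha ht]
  have hsin : Real.sin (a * (t + π * n / a)) = (-1) ^ n * Real.sin (a * t) := by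
    rw [show a * (t + π * n / a) = a * t + n * π by field_simp, Real.sin_add_int_mul_pi]
  rw [hsin]
  push_cast
  ring

/-- **The transform of a real trigonometric window off the lattice**:
`(Σ_{n∈s} x_n χ_n)^(½+it) = (2 sin(at)/√(2a)) · Σ_{n∈s} (−1)^n x_n/(t + πn/a)` when `t + πn/a ≠ 0` for all `n ∈ s`. -/
theorem weilMellin_sum_smul_chi_eq_sinc (ha : 0 < a) (s : Finset ℤ) (x : ℤ → ℝ) {t : ℝ}
    (ht : ∀ n ∈ s, t + π * n / a ≠ 0) :
    weilMellin (∑ n ∈ s, (x n : ℂ) • chi a n) (1 / 2 + t * I) =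
      ((2 * Real.sin (a * t) / Real.sqrt (2 * a) * ∑ n ∈ s, (-1 : ℝ) ^ n * x n / (t + π * n / a) : ℝ) : ℂ) := by
  rw [weilMellin_sum_smul_chi a s (fun n ↦ (x n : ℂ)) t]
  push_cast
  rw [Finset.mul_sum]
  refine Finset.sum_congr rfl fun n hn ↦ ?_
  rw [weilMellin_chi_eq_sinc ha n (ht n hn)]
  have h1 : ((t + π * n / a : ℝ) : ℂ) ≠ 0 := by exact_mod_cast ht n hn
  have h2 : ((Real.sqrt (2 * a) : ℝ) : ℂ) ≠ 0 := by
    exact_mod_cast (Real.sqrt_pos.2 (by linarith)).ne'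
  push_cast
  field_simp

/-- ★ **THE PROFILE OF A REAL TRIGONOMETRIC WINDOW** (what a certificate checker bounds from below on a block):
for `t` off the lattice points of `s`,

  `‖(Σ_{n∈s} x_n χ_n)^(½+it)‖² = (2/a)·sin²(at)·(Σ_{n∈s} (−1)^n x_n/(t + πn/a))²`. -/
theorem norm_sq_weilMellin_sum_smul_chi_eq (ha : 0 < a) (s : Finset ℤ) (x : ℤ → ℝ) {t : ℝ}
    (ht : ∀ n ∈ s, t + π * n / a ≠ 0) :
    ‖weilMellin (∑ n ∈ s, (x n : ℂ) • chi a n) (1 / 2 + t * I)‖ ^ 2 =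
      2 / a * Real.sin (a * t) ^ 2 * (∑ n ∈ s, (-1 : ℝ) ^ n * x n / (t + π * n / a)) ^ 2 := by
  rw [weilMellin_sum_smul_chi_eq_sinc ha s x ht, Complex.norm_real, Real.norm_eq_abs, sq_abs, mul_pow, div_pow,
    Real.sq_sqrt (by linarith)]
  field_simp

/-- **The profile at a lattice point of a mode outside `s`** is zero: if `t = −πk/a` with `k ∉ s` (and `a > 0`),
then `(Σ_{n∈s} x_n χ_n)^(½+it) = 0` (`sin(at) = sin(−πk) = 0`).  So a certificate never excludes the lattice
points of the modes it does not use — blocks must avoid them or include the mode. -/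
theorem weilMellin_sum_smul_chi_lattice_eq_zero (ha : 0 < a) (s : Finset ℤ) (x : ℤ → ℝ) {k : ℤ}
    (hk : k ∉ s) :
    weilMellin (∑ n ∈ s, (x n : ℂ) • chi a n) (1 / 2 + ((-(π * k / a) : ℝ) : ℂ) * I) = 0 := by
  have ht : ∀ n ∈ s, -(π * k / a) + π * n / a ≠ 0 := by
    intro n hn h
    have hne : n ≠ k := fun e ↦ hk (e ▸ hn)
    have : (π * (n - k) / a : ℝ) = 0 := by
      have e : (π * (n - k) / a : ℝ) = -(π * k / a) + π * n / a := by ring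
      rw [e]; exact h
    rcases div_eq_zero_iff.1 this with h1 | h1
    · rcases mul_eq_zero.1 h1 with h2 | h2
      · exact Real.pi_ne_zero h2
      · exact hne (by exact_mod_cast (sub_eq_zero.1 h2))
    · exact ha.ne' h1
  rw [weilMellin_sum_smul_chi_eq_sinc ha s x ht]
  have hsin : Real.sin (a * -(π * k / a)) = 0 := by
    rw [show a * -(π * k / a) = -(k * π) by field_simp, Real.sin_neg, ← zero_add ((k : ℝ) * π),
      Real.sin_add_int_mul_pi, Real.sin_zero, mul_zero, neg_zero]
  rw [hsin]
  simp

end Summit.Ventures.WeilGRH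

end
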